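import Summits.QuantumFields.BalabanUV.Beta.D1BFx.TorusGaugeBasisMatrix
import Summits.QuantumFields.BalabanUV.Beta.D1BFx.TorusGaugeWeight
import Summits.QuantumFields.BalabanUV.Beta.D1BFx.TorusZerothJunction

/-!
# `BalabanUV.Beta.D1BFx.TorusGaugeBasisKernel` — road «BF-x» for binder row D1, slot (K), X₃(ii) ROUTE T, brick **K-TB3b-N «THE BASIS FACTS OF `N̂`»**
# (owner ruling ρ-g6-12 (5)): the columns of leaf-03-g8's `TorusGaugeBasisMatrix.Nhat` — the periodised block-mean-free comb gauge functions — are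
# INDEPENDENT (`Nhat_injective`) and span EXACTLY the block-mean-free functions of the fine torus (`Nhat_range : Ŝλ = 0 ↔ λ ∈ range N̂`); hence the
# K-TB3b-J junction (`TorusGaugeWeight.junction`) and the zeroth-order weight junction (`TorusZerothJunction`) hold AT `N := N̂`, and PART 1's
# `Ŵ₀ = D̂ₛ · N̂` (`TorusHodgeWeight.DhatS`).

HONEST DEPENDENCY (cell records, verbatim): «continuum YM on T⁴ ⇐ BetaPertH ∧ nine spine estimates (0/9 proved); BetaPertH ⇐ (D1) ∧ (D4) ∧
CAP+tail; G-an2-4 gates asym, D1 and NE2/3/4.»  HONEST FRAMING (cell contract, verbatim): «discharging `BetaPertH` makes Bałaban's UV stability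
UNCONDITIONAL — a real constructive-QFT result; it is NOT the continuum limit and NOT the Clay problem.»  THIS MODULE DISCHARGES NOTHING of (K),
of D1 or of the wall: [folklore] finite linear algebra and periodisation bookkeeping over LANDED modules BY NAME — leaf-03-g8's `TorusGaugeBasis`
(`tauT_mul_What0`) and `TorusGaugeBasisMatrix` (`Nhat`, `NhatF`, `gradHat`, `bmF`, `dzF`, `What0_eq_grad_Nhat`, `rowBound_bmF`, `periodiseF_sub_matrix`),
gan24-leaf-01-g48's `ColumnSpaceProjector` (`injective_mulVec_of_left_inv`, `kernel_iff_range_of_reconstruction`), the owner's `TorusGaugeWeight.junction`,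
`TorusZerothJunction`, `PeriodisedProjector.Shat`∕`PeriodisedKernels`, gan24-leaf-06-g31's `TorusHodgeWeight` (`Dhat`, `DhatS`, `rowBound_dzKer`),
an2's `AxialProjectorBlockMean`∕`GaugeMultiplierBlockMean`∕`RootedComb` lattice gauge calculus (`treeGaugeAt_dz`, `treeGaugeAt_add'`,
`sum_delta1_sub_eq_dz_ind`, `blockMeanAt_ind`, `treeGaugeAt_eq_zero_of_axialGaugeAt`, `axialGaugeAt_delta1_of_not_isCombBond`), leaf-03-g7's
`FibredPeriodisation`.  No definition, no `def … : Prop`, nothing cited, 0 sorry.  NOT D1, NOT BetaPertH, NOT continuum, NOT Clay.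

ABSOLUTE RULE (cell charter, verbatim): «No internally-minted statement may enter as a cited fact. Every hypothesis is either kernel-proved in this
package or a verbatim quotation of a PUBLISHED theorem with page reference. The manuscript(s) under audit are NOT citable for their own disputed
steps — they are the thing under adjudication; programme-internal (2001/route/tribunal) claims are never citable.»

THE ARGUMENT (no dimension count).  LEFT INVERSE: `τ_T·Ŵ₀ = 1` (PART 1) and `Ŵ₀ = ĝradₑ·N̂` (PART 2) give `(τ_T·ĝradₑ)·N̂ = 1` ⟹ `N̂` injective.
RECONSTRUCTION: on the lattice `bmF ∘ dzF = δ − n^{−(d+1)}·1[same block]` (§2: the comb integral of `dz 𝟙_{w′}` is `𝟙_{w′}` minus its block mean —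
`treeGaugeAt_dz`, `blockMeanAt_ind`, additivity of `bmGaugeAt` and `sum_delta1_sub_eq_dz_ind`), periodised (§3) to `N̂F·ĝrad = 1 − n^{−(d+1)}•Ŝ`; the
NON-COMB columns of `N̂F` vanish (the indicator of a non-comb bond is in the rooted axial gauge, so its comb integral is `0`), so `N̂F·ĝrad = N̂·(τ_T·ĝradₑ)`;
then `ColumnSpaceProjector.kernel_iff_range_of_reconstruction` (`Ŝ·N̂ = 0` itself follows from the two identities: `N̂ = N̂·T·N̂ = N̂ − n^{−(d+1)}•Ŝ·N̂`).
CONTENT: §1 `tauT_grad_mul_Nhat`, **`Nhat_injective`** (generic `d`); §2 lattice: `bmGaugeAt_add`∕`_sub`∕`_finset_sum`, `bmGaugeAt_dz`, `tsum_mul_dzKer`,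
**`compF_bmF_dzF`**; §3 fine torus (generic `d`): `NhatF_mul_gradHat`, `NhatF_apply_e₁_of_not_comb`, `Nhat_mul_tauT`, **`Nhat_mul_tauT_grad`**
(`N̂·(τ_T·ĝradₑ) = 1 − n^{−(d+1)}•Ŝ_gen`); §4 `d = 3`, `n = m+1`: `sameBlockHat_eq_Shat`, `Shat_mul_Nhat`, **`Nhat_range`**, `gradHat_eq_Dhat` (`rfl`),
**`What0_eq_DhatS_mul_Nhat`**, and the instantiations **`junction_Nhat`**, **`two_smul_Xhat_zero_eq_gram_Nhat`**, **`NT_eq_kkt_gram_Nhat`**.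
Provenance: NE9 formalisation swarm leaf seat `b2b-balaban-t4-ne9-formalise-leaf-09` gen 38 (cross-row prover duty; journal CLAIM l.23272), 2026-08-20.
-/

noncomputable section

namespace Summit.QuantumFields.BalabanUV.Beta.D1BFx.TorusGaugeBasisKernel

open Matrix
open Literature.Probability.LatticeModels (TorusSite Torus.proj)
open Literature.MathematicalPhysics.QuantumFieldTheory.LatticeForm (repZ quo)
open Literature.MathematicalPhysics.QuantumFieldTheory.Balaban1983to89
open Literature.MathematicalPhysics.QuantumFieldTheory.Balaban1983to89.Beta
open AffineAveraging (box toSite unitVec blockSum dz Form0 Form1)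
open AveragingContours (blk grad blk_block blk_add_off off off_mem_box)
open AveragingContoursRooted (treeGaugeAt AxialGaugeAt)
open RootedComb (treeGaugeAt_eq_zero_of_axialGaugeAt)
open KKTFluctuationKernel (delta1 delta1_apply)
open Summit.QuantumFields.BalabanUV.Beta.AxialProjectorBlockMean (blockMeanAt bmGaugeAt)
open Summit.QuantumFields.BalabanUV.Beta.AxialDressingRooted (IsCombBondAt)
open Summit.QuantumFields.BalabanUV.Beta.BorderedHessian (ind sum_delta1_sub_eq_dz_ind blockMeanAt_ind treeGaugeAt_add' treeGaugeAt_dz blockMeanAt_add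
  blockMeanAt_sub blockMeanAt_blockConst' axialGaugeAt_delta1_of_not_isCombBond)
open Summit.QuantumFields.BalabanUV.Beta.D1BFx.FibredPeriodisation
open Summit.QuantumFields.BalabanUV.Beta.D1BFx.SortedKernels
open Summit.QuantumFields.BalabanUV.Beta.D1BFx.SortedReblocking
open Summit.QuantumFields.BalabanUV.Beta.D1BFx.SortedEmbedding (e₁ e₁_apply)
open Summit.QuantumFields.BalabanUV.Beta.D1BFx.StencilKernels (dzKer isPeriodic₂_dzKer summable_dzKer_row)
open Summit.QuantumFields.BalabanUV.Beta.D1BFx.TorusCombKKT (I J CombRows tauT tauT_apply tauT_mul_transpose isCombBondAt_finePt_iff Khat Qhat)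
open Summit.QuantumFields.BalabanUV.Beta.D1BFx.TorusGaugeBasis (What0 tauT_mul_What0)
open Summit.QuantumFields.BalabanUV.Beta.D1BFx.TorusGaugeBasisMatrix (dzF bmF gradHat NhatF Nhat Nhat_apply What0_eq_grad_Nhat isPeriodic₂_bmF rowBound_bmF
  periodiseF_sub_matrix summable_Kfib_kdeltaF)
open Summit.QuantumFields.BalabanUV.Beta.D1BFx.TorusHodgeWeight (Dhat DhatS rowBound_dzKer)
open Summit.QuantumFields.BalabanUV.Beta.D1BFx.PeriodisedProjector (Shat Lhat Phat)
open Summit.QuantumFields.BalabanUV.Beta.D1BFx.TorusBorderedResolvent (Xhat NT)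
open Summit.QuantumFields.BalabanUV.Beta.D1BFx.ColumnSpaceProjector (injective_mulVec_of_left_inv kernel_iff_range_of_reconstruction)
open scoped BigOperators

variable {d : ℕ} (r : Fin (d + 1) → ℕ) (n p : ℕ) [NeZero n] [NeZero p]

/-! ## §1 Independence: the comb evaluation `τ_T·ĝradₑ` is a left inverse of `N̂` -/

/-- [folklore] **`(τ_T · ĝradₑ) · N̂ = 1`**: the comb components of the torus gradient of `N̂ c` return `c` (PART 1 `tauT_mul_What0`, PART 2 `What0_eq_grad_Nhat`). -/
theorem tauT_grad_mul_Nhat (hr : r ∈ box (d + 1) n) :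
    tauT (toSite r) n p * (gradHat (d := d) (n * p)).submatrix (e₁ n p) id * Nhat r n p = 1 := by
  rw [Matrix.mul_assoc, ← What0_eq_grad_Nhat r n p hr, tauT_mul_What0]

/-- [folklore] **`N̂` HAS INDEPENDENT COLUMNS**: `Function.Injective (Nhat r n p).mulVec` (`ColumnSpaceProjector.injective_mulVec_of_left_inv`). -/
theorem Nhat_injective (hr : r ∈ box (d + 1) n) : Function.Injective (Nhat r n p).mulVec :=
  injective_mulVec_of_left_inv (tauT_grad_mul_Nhat r n p hr)

/-! ## §2 The lattice identity `bmF ∘ dzF = δ − n^{−(d+1)}·1[same block]` -/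

section Lattice

variable {n}

omit [NeZero n] in
/-- [folklore] `bmGaugeAt` is additive in the form (`treeGaugeAt_add'`, `blockMeanAt_add`). -/
theorem bmGaugeAt_add (ρ : Fin (d + 1) → ℤ) (A B : Form1 (d + 1) ℝ) :
    bmGaugeAt ρ (A + B) n = bmGaugeAt ρ A n + bmGaugeAt ρ B n := by
  unfold AxialProjectorBlockMean.bmGaugeAt
  rw [treeGaugeAt_add', blockMeanAt_add]
  abel

omit [NeZero n] in
/-- [folklore] `bmGaugeAt` of the zero form vanishes. -/
theorem bmGaugeAt_zero (ρ : Fin (d + 1) → ℤ) : bmGaugeAt ρ (0 : Form1 (d + 1) ℝ) n = 0 := by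
  have h := bmGaugeAt_add (n := n) ρ (0 : Form1 (d + 1) ℝ) 0
  rw [add_zero] at h
  exact add_eq_left.mp h.symm

omit [NeZero n] in
/-- [folklore] `bmGaugeAt` is subtractive in the form. -/
theorem bmGaugeAt_sub (ρ : Fin (d + 1) → ℤ) (A B : Form1 (d + 1) ℝ) :
    bmGaugeAt ρ (A - B) n = bmGaugeAt ρ A n - bmGaugeAt ρ B n := by
  have h := bmGaugeAt_add (n := n) ρ (A - B) B
  rw [sub_add_cancel] at h
  exact eq_sub_of_add_eq h.symm

omit [NeZero n] in
/-- [folklore] `bmGaugeAt` of a finite sum of forms. -/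
theorem bmGaugeAt_finset_sum {ι : Type*} (ρ : Fin (d + 1) → ℤ) (S : Finset ι) (A : ι → Form1 (d + 1) ℝ) :
    bmGaugeAt ρ (∑ i ∈ S, A i) n = ∑ i ∈ S, bmGaugeAt ρ (A i) n := by
  classical
  induction S using Finset.induction_on with
  | empty => simp [bmGaugeAt_zero]
  | insert i S hi ih => rw [Finset.sum_insert hi, Finset.sum_insert hi, bmGaugeAt_add, ih]

/-- [folklore] **THE COMB INTEGRAL OF AN EXACT FORM**: `bmGaugeAt ρ (dz f) n = f − blockMeanAt n f` (`treeGaugeAt_dz`: the tree integral is `f − f(root)`,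
whose block mean is `blockMeanAt n f − f(root)`). -/
theorem bmGaugeAt_dz (ρ : Fin (d + 1) → ℤ) (f : Form0 (d + 1) ℝ) : bmGaugeAt ρ (dz f) n = f - blockMeanAt n f := by
  have hN : 1 ≤ n := NeZero.one_le
  have htg : treeGaugeAt ρ (dz f) n = f - fun x => f ((n : ℤ) • blk n x + ρ) := by
    funext x; rw [treeGaugeAt_dz]; rfl
  have hbm : blockMeanAt n (treeGaugeAt ρ (dz f) n) = blockMeanAt n f - fun x => f ((n : ℤ) • blk n x + ρ) := by
    rw [htg, blockMeanAt_sub]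
    congr 1
    funext x
    exact blockMeanAt_blockConst' hN (fun y => f ((n : ℤ) • y + ρ)) x
  unfold AxialProjectorBlockMean.bmGaugeAt
  rw [hbm, htg]
  abel

omit [NeZero n] in
/-- [folklore] The two-point column sum against `dzKer`: `Σ'_X g X · dzKer β X w′ = g (w′ − e_β) − g w′`. -/
theorem tsum_mul_dzKer (β : Fin (d + 1)) (w' : Fin (d + 1) → ℤ) (g : (Fin (d + 1) → ℤ) → ℝ) :
    ∑' X, g X * dzKer β X w' = g (w' - unitVec β) - g w' := by
  have e : (fun X => g X * dzKer β X w') = fun X => (if X = w' - unitVec β then g X else 0) - (if X = w' then g X else 0) := by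
    funext X
    simp only [dzKer]
    have h1 : (w' = X + unitVec β) ↔ (X = w' - unitVec β) := by
      constructor
      · intro h; rw [h]; abel
      · intro h; rw [h]; abel
    by_cases hX : X = w' - unitVec β
    · have hX' : X ≠ w' := by rw [hX]; intro h; have := congrArg (fun v => v - w') h; simp [unitVec] at this
      rw [if_pos (h1.2 hX), if_pos hX, if_neg (Ne.symm hX'), if_neg hX']; ring
    · rw [if_neg (fun h => hX (h1.1 h)), if_neg hX]
      by_cases hX' : X = w'
      · rw [if_pos hX'.symm, if_pos hX']; ring
      · rw [if_neg (Ne.symm hX'), if_neg hX']; ring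
  rw [e, Summable.tsum_sub, tsum_eq_single (w' - unitVec β) (fun X hX => if_neg hX), if_pos rfl, tsum_eq_single w' (fun X hX => if_neg hX), if_pos rfl]
  · exact summable_of_ne_finset_zero (s := {w' - unitVec β}) fun X hX => by
      rw [Finset.mem_singleton] at hX; rw [if_neg hX]
  · exact summable_of_ne_finset_zero (s := {w'}) fun X hX => by
      rw [Finset.mem_singleton] at hX; rw [if_neg hX]

/-- [folklore] **THE LATTICE IDENTITY `bmF ∘ dzF = δ − n^{−(d+1)}·1[same block]`**: the comb integral of `dz 𝟙_{w′}` is `𝟙_{w′}` minus its block mean. -/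
theorem compF_bmF_dzF :
    compF (bmF r n) (dzF (d := d))
      = kdeltaF - fun i j => if blk n j.1 = blk n i.1 then (((n : ℝ) ^ (d + 1))⁻¹) else 0 := by
  have hN : 1 ≤ n := NeZero.one_le
  funext ⟨w, u⟩ ⟨w', u'⟩
  rw [Pi.sub_apply, Pi.sub_apply]
  simp only [compF]
  have h1 : ∀ β : Fin (d + 1), ∑' X : Fin (d + 1) → ℤ, bmF r n (w, u) (X, β) * dzF (X, β) (w', u')
      = bmGaugeAt (toSite r) (delta1 β (w' - unitVec β)) n w - bmGaugeAt (toSite r) (delta1 β w') n w := fun β =>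
    tsum_mul_dzKer β w' (fun X => bmGaugeAt (toSite r) (delta1 β X) n w)
  rw [Finset.sum_congr rfl fun β _ => h1 β]
  have h2 : ∑ β : Fin (d + 1), (bmGaugeAt (toSite r) (delta1 β (w' - unitVec β)) n w - bmGaugeAt (toSite r) (delta1 β w') n w)
      = bmGaugeAt (toSite r) (∑ β : Fin (d + 1), (delta1 β (w' - unitVec β) - delta1 β w')) n w := by
    rw [bmGaugeAt_finset_sum, Finset.sum_apply]
    exact Finset.sum_congr rfl fun β _ => by rw [bmGaugeAt_sub, Pi.sub_apply]
  rw [h2, sum_delta1_sub_eq_dz_ind, bmGaugeAt_dz, Pi.sub_apply, blockMeanAt_ind hN, kdeltaF]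
  simp only [ind, Prod.mk.injEq]
  by_cases h : w = w'
  · simp [h]
  · simp [h]

end Lattice

/-! ## §3 On the fine torus: `N̂F·ĝrad = 1 − n^{−(d+1)}•Ŝ_gen`, the non-comb columns of `N̂F` vanish, `N̂·(τ_T·ĝradₑ) = N̂F·ĝrad` -/

section FineTorus

/-- [folklore] Rows of the same-block kernel are finitely supported (one block), hence summable. -/
theorem summable_sameBlock_row (c : ℝ) (w : Fin (d + 1) → ℤ) :
    Summable fun w' : Fin (d + 1) → ℤ => if blk n w' = blk n w then c else 0 := by
  have hN : 1 ≤ n := NeZero.one_le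
  refine summable_of_ne_finset_zero (s := (box (d + 1) n).image fun b => (n : ℤ) • blk n w + toSite b) fun w' hw' => ?_
  rw [if_neg]
  intro h
  apply hw'
  rw [Finset.mem_image]
  exact ⟨off n w', off_mem_box hN w', by rw [← h, blk_add_off hN]⟩

omit [NeZero n] in
/-- [folklore] `N̂F · ĝrad = (bmF)^ · (dzF)^` (the trivial site fibre summed out). -/
theorem NhatF_mul_gradHat_eq (s : ℕ) [NeZero s] :
    NhatF r n s * gradHat (d := d) s
      = (Matrix.of (periodiseF s (bmF r n)) * Matrix.of (periodiseF s (dzF (d := d)))).submatrix (fun x => (x, PUnit.unit)) (fun y => (y, PUnit.unit)) := by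
  ext x y
  rw [Matrix.submatrix_apply, Matrix.mul_apply, Matrix.mul_apply]
  rfl

/-- [folklore] **`N̂F · ĝrad = 1 − n^{−(d+1)} • Ŝ_gen` ON THE FINE TORUS** (`compF_bmF_dzF` periodised by the product rule; `Ŝ_gen` = the periodised
same-block indicator of block side `n`). -/
theorem NhatF_mul_gradHat (hr : r ∈ box (d + 1) n) :
    NhatF r n (n * p) * gradHat (d := d) (n * p)
      = 1 - (((n : ℝ) ^ (d + 1))⁻¹ • Matrix.of fun x y : Beta.Site (d + 1) (n * p) =>
          periodise₂ (n * p) (fun w w' : Fin (d + 1) → ℤ => if blk n w = blk n w' then (1 : ℝ) else 0) x y) := by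
  rw [NhatF_mul_gradHat_eq, ← periodiseF_compF_matrix (fun a b x => (rowBound_bmF r n hr a b x).1)
    (fun β u => by exact isPeriodic₂_dzKer β (n * p)) (fun β u => by exact rowBound_dzKer β), compF_bmF_dzF r,
    periodiseF_sub_matrix (summable_Kfib_kdeltaF) (fun a b x => ?_), periodiseF_kdeltaF_matrix]
  · ext x y
    rw [Matrix.submatrix_apply, Matrix.sub_apply, Matrix.sub_apply, Matrix.one_apply, Matrix.one_apply, Matrix.smul_apply, Matrix.of_apply,
      Matrix.of_apply, periodiseF_apply, smul_eq_mul]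
    simp only [Prod.mk.injEq, and_true]
    congr 1
    rw [show Kfib (fun i j : (Fin (d + 1) → ℤ) × Unit => if blk n j.1 = blk n i.1 then (((n : ℝ) ^ (d + 1))⁻¹) else 0) PUnit.unit PUnit.unit
        = fun w w' => ((n : ℝ) ^ (d + 1))⁻¹ * (if blk n w = blk n w' then (1 : ℝ) else 0) from ?_]
    · exact periodise₂_const_mul _ _ x y
    · funext w w'
      simp only [Kfib_apply, mul_ite, mul_one, mul_zero, eq_comm]
  · exact summable_sameBlock_row n _ x

/-- [folklore] **THE NON-COMB COLUMNS OF `N̂F` VANISH**: the indicator of a non-comb bond is in the rooted axial gauge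
(`axialGaugeAt_delta1_of_not_isCombBond`), so its comb integral — and the block-mean-free version — is `0` (`treeGaugeAt_eq_zero_of_axialGaugeAt`). -/
theorem NhatF_apply_e₁_of_not_comb (hr : r ∈ box (d + 1) n) (x : Beta.Site (d + 1) (n * p)) (i : I d n p)
    (hi : ¬ IsCombBondAt (toSite r) n i.2.2 (repZ i.2.1)) : NhatF r n (n * p) x (e₁ n p i) = 0 := by
  have hN : 1 ≤ n := NeZero.one_le
  obtain ⟨ybar, z, β⟩ := i
  rw [e₁_apply, torusBlockEquiv_apply]
  show periodise₂ (n * p) (fun w X => bmGaugeAt (toSite r) (delta1 β X) n w) x (siteOf (d + 1) (n * p) (finePt n (windowMap (d + 1) p ybar) z)) = 0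
  rw [periodise₂_eq_tsum_of_rep (K := fun w X => bmGaugeAt (toSite r) (delta1 β X) n w) (isPeriodic₂_bmF r n p PUnit.unit β)
    (fun w => (rowBound_bmF r n hr PUnit.unit β w).1.of_abs) (siteOf_windowMap (d + 1) (n * p) x) rfl]
  refine (tsum_congr fun t => ?_).trans tsum_zero
  rw [← finePt_imageShift]
  have hc : ¬ IsCombBondAt (toSite r) n β (finePt n (imageShift p (windowMap (d + 1) p ybar) t) z) := by rwa [isCombBondAt_finePt_iff]
  show bmGaugeAt (toSite r) (delta1 β (finePt n (imageShift p (windowMap (d + 1) p ybar) t) z)) n (windowMap (d + 1) (n * p) x) = 0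
  unfold AxialProjectorBlockMean.bmGaugeAt
  rw [treeGaugeAt_eq_zero_of_axialGaugeAt hN (axialGaugeAt_delta1_of_not_isCombBond hN hr hc)]
  simp [blockMeanAt, blockSum]

open Classical in
/-- [folklore] **`N̂ · τ_T = N̂F` re-indexed by `e₁`**: on comb columns by definition of `N̂`, on non-comb columns both sides vanish. -/
theorem Nhat_mul_tauT (hr : r ∈ box (d + 1) n) :
    Nhat r n p * tauT (toSite r) n p = (NhatF r n (n * p)).submatrix id (e₁ n p) := by
  ext x i
  rw [Matrix.mul_apply, Matrix.submatrix_apply, id]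
  by_cases hi : IsCombBondAt (toSite r) n i.2.2 (repZ i.2.1)
  · rw [Finset.sum_eq_single ⟨i, hi⟩]
    · rw [tauT_apply, if_pos rfl, mul_one, Nhat_apply]
    · intro b _ hb
      rw [tauT_apply, if_neg (fun h => hb (Subtype.ext h.symm)), mul_zero]
    · intro h; exact absurd (Finset.mem_univ _) h
  · rw [NhatF_apply_e₁_of_not_comb r n p hr x i hi]
    exact Finset.sum_eq_zero fun b _ => by rw [tauT_apply, if_neg (fun h => hi (by rw [h]; exact b.2)), mul_zero]

/-- [folklore] **THE RECONSTRUCTION IDENTITY `N̂ · (τ_T · ĝradₑ) = 1 − n^{−(d+1)} • Ŝ_gen`**: a function's comb integral of the comb components of its torus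
gradient is the function minus its torus block mean. -/
theorem Nhat_mul_tauT_grad (hr : r ∈ box (d + 1) n) :
    Nhat r n p * (tauT (toSite r) n p * (gradHat (d := d) (n * p)).submatrix (e₁ n p) id)
      = 1 - (((n : ℝ) ^ (d + 1))⁻¹ • Matrix.of fun x y : Beta.Site (d + 1) (n * p) =>
          periodise₂ (n * p) (fun w w' : Fin (d + 1) → ℤ => if blk n w = blk n w' then (1 : ℝ) else 0) x y) := by
  rw [← Matrix.mul_assoc, Nhat_mul_tauT r n p hr, ← NhatF_mul_gradHat r n p hr, Matrix.submatrix_mul_equiv, Matrix.submatrix_id_id]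

end FineTorus

/-! ## §4 `d = 3`, block side `n = m + 1`: `ker Ŝ = range N̂`, `Ŵ₀ = D̂ₛ·N̂`, the junctions at `N := N̂` -/

section Road

variable (r : Fin (3 + 1) → ℕ) (m : ℕ) {a : ℝ} (p : ℕ) [NeZero p]

/-- [folklore] The pv23 block label at side `m + 1` is the cell's `blk (m+1)`. -/
theorem blk_pv23_eq (w : Fin (3 + 1) → ℤ) : B6QGQLower276.blk m w = blk (m + 1) w := by
  funext μ
  show w μ / B6QGQLower276.side m = w μ / (((m + 1 : ℕ) : ℤ))
  rw [B6QGQLower276.side]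
  push_cast
  rfl

/-- [folklore] **THE GENERIC SAME-BLOCK MATRIX IS `PeriodisedProjector.Shat`** at `d = 3`, block side `m + 1`. -/
theorem sameBlockHat_eq_Shat :
    (Matrix.of fun x y : Beta.Site (3 + 1) ((m + 1) * p) =>
        periodise₂ ((m + 1) * p) (fun w w' : Fin (3 + 1) → ℤ => if blk (m + 1) w = blk (m + 1) w' then (1 : ℝ) else 0) x y)
      = Shat m ((m + 1) * p) := by
  have e : (fun w w' : Fin (3 + 1) → ℤ => if blk (m + 1) w = blk (m + 1) w' then (1 : ℝ) else 0) = B6QGQLower276.sameBlk (d := 4) m := by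
    funext w w'
    rw [B6QGQLower276.sameBlk, blk_pv23_eq, blk_pv23_eq]
  rw [e]
  rfl

/-- [folklore] **THE RECONSTRUCTION IDENTITY ON THE ROAD**: `N̂·(τ_T·ĝradₑ) = 1 − (m+1)⁻⁴ • Ŝ`. -/
theorem Nhat_mul_tauT_grad_road (hr : r ∈ box (3 + 1) (m + 1)) :
    Nhat r (m + 1) p * (tauT (toSite r) (m + 1) p * (gradHat (d := 3) ((m + 1) * p)).submatrix (e₁ (m + 1) p) id)
      = 1 - ((((m : ℝ) + 1) ^ 4)⁻¹ • Shat m ((m + 1) * p)) := by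
  rw [Nhat_mul_tauT_grad r (m + 1) p hr, sameBlockHat_eq_Shat]
  push_cast
  rfl

/-- [folklore] **`Ŝ · N̂ = 0`**: the columns of `N̂` are block-mean-free — read off the two identities: `N̂ = N̂·(T·N̂) = (1 − c•Ŝ)·N̂`. -/
theorem Shat_mul_Nhat (hr : r ∈ box (3 + 1) (m + 1)) : Shat m ((m + 1) * p) * Nhat r (m + 1) p = 0 := by
  have h1 := Nhat_mul_tauT_grad_road r m p hr
  have h2 := tauT_grad_mul_Nhat r (m + 1) p hr
  have h3 : Nhat r (m + 1) p * (tauT (toSite r) (m + 1) p * (gradHat (d := 3) ((m + 1) * p)).submatrix (e₁ (m + 1) p) id) * Nhat r (m + 1) p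
      = Nhat r (m + 1) p := by rw [Matrix.mul_assoc, h2, Matrix.mul_one]
  rw [h1, Matrix.sub_mul, Matrix.one_mul, Matrix.smul_mul, sub_eq_self, smul_eq_zero] at h3
  exact h3.resolve_left (inv_ne_zero (pow_ne_zero 4 (by positivity)))

/-- [folklore] **`ker Ŝ = range N̂` — THE BASIS FACT OF K-TB3b-N**: a function on the fine torus `Site 4 ((m+1)·p)` has vanishing torus block sums iff
it is a combination of the periodised block-mean-free comb gauge functions (`ColumnSpaceProjector.kernel_iff_range_of_reconstruction`). -/
theorem Nhat_range (hr : r ∈ box (3 + 1) (m + 1)) (lam : Beta.Site (3 + 1) ((m + 1) * p) → ℝ) :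
    Shat m ((m + 1) * p) *ᵥ lam = 0 ↔ ∃ c : CombRows (toSite r) (m + 1) p → ℝ, lam = Nhat r (m + 1) p *ᵥ c :=
  kernel_iff_range_of_reconstruction (Shat_mul_Nhat r m p hr) (Nhat_mul_tauT_grad_road r m p hr)
    (fun lam h => by rw [Matrix.smul_mulVec, h, smul_zero]) lam

/-- [folklore] **BRIDGE**: leaf-03's `gradHat` IS gan24-leaf-06's `TorusHodgeWeight.Dhat` (same definition), by `rfl`. -/
theorem gradHat_eq_Dhat (s : ℕ) [NeZero s] : gradHat (d := d) s = Dhat (d + 1) s := rfl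

/-- [folklore] **`Ŵ₀ = D̂ₛ · N̂`**: PART 1's gauge-basis matrix is the sorted fine-torus gradient `TorusHodgeWeight.DhatS` of the basis matrix `N̂`. -/
theorem What0_eq_DhatS_mul_Nhat (hr : r ∈ box (3 + 1) (m + 1)) : What0 r (m + 1) p = DhatS m p * Nhat r (m + 1) p :=
  What0_eq_grad_Nhat r (m + 1) p hr

/-- [folklore] **THE K-TB3b-J JUNCTION AT `N := N̂`**: `NᵀL̂L̂N` is invertible and `1 − P̂ = L̂N̂(N̂ᵀL̂L̂N̂)⁻¹N̂ᵀL̂` (`TorusGaugeWeight.junction`). -/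
theorem junction_Nhat (ha : 0 < a) (hr : r ∈ box (3 + 1) (m + 1)) :
    IsUnit ((Nhat r (m + 1) p)ᵀ * Lhat ((m + 1) * p) * Lhat ((m + 1) * p) * Nhat r (m + 1) p).det ∧
      1 - Phat m a ((m + 1) * p) = Lhat ((m + 1) * p) * Nhat r (m + 1) p
        * ((Nhat r (m + 1) p)ᵀ * Lhat ((m + 1) * p) * Lhat ((m + 1) * p) * Nhat r (m + 1) p)⁻¹ * (Nhat r (m + 1) p)ᵀ * Lhat ((m + 1) * p) :=
  TorusGaugeWeight.junction ha rfl (Nhat_range r m p hr) (Nhat_injective r (m + 1) p hr)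

/-- [folklore] **THE ZEROTH-ORDER WEIGHT JUNCTION AT `N := N̂`** (`TorusZerothJunction.two_smul_Xhat_zero_eq_gram`): `2•X̂(0) = K̂ + T₀ᵀA₀T₀`,
`T₀ = N̂ᵀL̂D̂ₛᵀ`, `A₀ = 2•(N̂ᵀL̂L̂N̂)⁻¹`. -/
theorem two_smul_Xhat_zero_eq_gram_Nhat (ha : 0 < a) (hr : r ∈ box (3 + 1) (m + 1)) :
    (2 : ℝ) • Xhat m a p 0 = Khat (d := 3) (m + 1) p
      + ((Nhat r (m + 1) p)ᵀ * Lhat ((m + 1) * p) * (DhatS m p)ᵀ)ᵀ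
          * ((2 : ℝ) • ((Nhat r (m + 1) p)ᵀ * Lhat ((m + 1) * p) * Lhat ((m + 1) * p) * Nhat r (m + 1) p)⁻¹)
          * ((Nhat r (m + 1) p)ᵀ * Lhat ((m + 1) * p) * (DhatS m p)ᵀ) :=
  TorusZerothJunction.two_smul_Xhat_zero_eq_gram m p ha (Nhat_range r m p hr) (Nhat_injective r (m + 1) p hr)

/-- [folklore] **`N_T = kkt (K̂ + T₀ᵀA₀T₀) Q̂` AT `N := N̂`** (`TorusZerothJunction.NT_eq_kkt_gram`). -/
theorem NT_eq_kkt_gram_Nhat (ha : 0 < a) (hr : r ∈ box (3 + 1) (m + 1)) :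
    NT m a p = Composition.kkt (Khat (d := 3) (m + 1) p
      + ((Nhat r (m + 1) p)ᵀ * Lhat ((m + 1) * p) * (DhatS m p)ᵀ)ᵀ
          * ((2 : ℝ) • ((Nhat r (m + 1) p)ᵀ * Lhat ((m + 1) * p) * Lhat ((m + 1) * p) * Nhat r (m + 1) p)⁻¹)
          * ((Nhat r (m + 1) p)ᵀ * Lhat ((m + 1) * p) * (DhatS m p)ᵀ)) (Qhat (d := 3) (m + 1) p) :=
  TorusZerothJunction.NT_eq_kkt_gram m p ha (Nhat_range r m p hr) (Nhat_injective r (m + 1) p hr)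

end Road

end Summit.QuantumFields.BalabanUV.Beta.D1BFx.TorusGaugeBasisKernel

end
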